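import Literature.NumberTheory.EllipticCurves.PAdicOneVariableNormCoherentUnitFamilyOfCharacter
import Literature.NumberTheory.EllipticCurves.PAdicOneVariableGaloisMomentsOfColemanTraceTwo
import HarnessLib

/-!
# `p = 2`, ABSTRACT TOWER: the COSET FORMULA for the moments of `i(b)` — de Shalit II.4.7 (16)–(17):
# `∫_G κ^{k+1} d i(b) = Σ_{c ∈ G/U_0} κ(r_c)^{k+1} · [S^0] D^k H_{η(r_c⁻¹ • b)}`

Topic `NumberTheory/EllipticCurves`; namespace `Literature.NumberTheory.EllipticCurves`.

De Shalit, *Iwasawa theory of elliptic curves with complex multiplication* (1987), II.4.7 (p. 60), proof of (16):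
"`∫_𝒢 χφ^k dμ_β = Σ_𝔠 ∫_{σ_𝔠⁻¹G} χφ^k(σ) dμ_β(σ) = Σ_𝔠 χφ^k(σ_𝔠⁻¹) · ∫_G φ^k dμ⁰_{σ_𝔠(β)}`" and (17): the inner
integrals are the numbers `δ_k`.  With `i := GroupDistribution.induce D` along an ABSTRACT tower `(G, 𝒰, κ)`
(`PAdicOneVariableNormCoherentUnitFamilyOfCharacter.lean`) and the abstract-tower moments of the pulled-back
log-free measures (`integral_comap_character_pow_succ_of_colemanTrace_eq_zero`,
`PAdicOneVariableGaloisMomentsOfColemanTraceTwo.lean`), this file proves, for `𝕜 = ℂ_[2]` and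
`Θ = θ ∘ (𝒪_{ℂ_F} ⊆ ℂ_F) ∘ (𝐃 → 𝒪_{ℂ_F})`:

* §1 `SubgroupTower.isTowerContinuous_padicIntCast_character_pow` — `g ↦ κ(g)^{k+1}` (read in `𝕜`) is
  tower-continuous on ALL of `G` (`U_n ⊆ {κ ≡ 1 mod 2^{n+1}}`);
* §2 `comap_μ_normCoherentUnits_comp_eq_of_character` — the `Θ`- and `θ`-currency measures agree levelwise
  (abstract-tower twin of `comap_μ_normCoherentUnits_comp_eq`); `integral_comap_indicator_character_pow_succ_normCoherentUnits_of_character`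
  — **`∫_G 𝟙_{U_0} κ^{k+1} dD_b = [S^0] D^k H_{η b}`** (de Shalit (10)+(11) along the abstract tower);
* §3 ★★★ `integral_induce_character_pow_succ_of_character` — **the coset formula (16)–(17)**:
  `∫_G κ(g)^{k+1} d i(b)(g) = Σ_{c ∈ 𝒰.cells 0} κ(r_c)^{k+1} · [S^0] D^k H_{η(r_c⁻¹ • b)}`, `r_c = 𝒰.repr 0 c`.

Everything is proved; no named facts, no definitions, no instances (section-local instance attributes as in the
siblings), no `sorry`.

## References

* [deShalit1987] E. de Shalit, *Iwasawa theory of elliptic curves with complex multiplication* (1987),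
  II.4.7 (16)–(17) (p. 60), I.3.4 (10), I.3.5 (11) (p. 18), II.4.6 (14) (p. 59).
-/

noncomputable section

open MvPowerSeries Filter
open scoped Topology Classical

namespace Literature.NumberTheory.EllipticCurves

/-! ### §1. `κ^{k+1}` is tower-continuous on `G` -/

namespace SubgroupTower

variable {G : Type*} [Group G] {𝒰 : SubgroupTower G} {p : ℕ} [Fact p.Prime]
  {𝕜 : Type*} [NormedField 𝕜] [NormedAlgebra ℚ_[p] 𝕜] (κ : G →* ℤ_[p]ˣ)
  (hU : ∀ (n : ℕ) (g : G), g ∈ 𝒰.U n ↔ g ∈ 𝒰.U 0 ∧ PadicInt.toZModPow (n + 1) (κ g : ℤ_[p]) = 1)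

include hU in
/-- On a `U_n`-coset the character is constant modulo `p^{n+1}`. [cite: deShalit1987, I.3.3 (9) (p. 18)] -/
theorem toZModPow_coe_character_eq_of_proj_eq {n : ℕ} {g g' : G} (h : 𝒰.proj n g = 𝒰.proj n g') :
    PadicInt.toZModPow (n + 1) (κ g : ℤ_[p]) = PadicInt.toZModPow (n + 1) (κ g' : ℤ_[p]) := by
  have hmem : g⁻¹ * g' ∈ 𝒰.U n := by
    rw [SubgroupTower.proj_apply, SubgroupTower.proj_apply] at h
    exact QuotientGroup.eq.mp h
  have h1 := ((hU n _).mp hmem).2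
  have hg' : g' = g * (g⁻¹ * g') := by rw [mul_inv_cancel_left]
  conv_rhs => rw [hg', toZModPow_coe_character_mul κ, h1, mul_one]

include hU in
/-- **`g ↦ κ(g)^m` (read in `𝕜`) is tower-continuous on `G`.** [cite: deShalit1987, I.3.1 (p. 16), I.3.3 (9) (p. 18)] -/
theorem isTowerContinuous_padicIntCast_character_pow (m : ℕ) :
    𝒰.IsTowerContinuous (fun g ↦ padicIntCast 𝕜 ((κ g : ℤ_[p]) ^ m)) := by
  intro ε hε
  obtain ⟨δ, hδ, hgδ⟩ := Metric.uniformContinuous_iff.mp (uniformContinuous_padicIntCast_pow (𝕜 := 𝕜) (p := p) m) ε hε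
  obtain ⟨N, hN⟩ := (ProfiniteTower.padicInt p).succ.exists_forall_dist_lt δ hδ
  refine ⟨N, fun n hn g g' hgg' ↦ hgδ (hN n hn _ _ ?_)⟩
  rw [ProfiniteTower.succ_proj, ProfiniteTower.padicInt_proj, ProfiniteTower.succ_proj, ProfiniteTower.padicInt_proj]
  exact toZModPow_coe_character_eq_of_proj_eq κ hU hgg'

end SubgroupTower

/-! ### §2. The `Θ`/`θ` bridge and de Shalit's (10)+(11) along the abstract tower -/

section InduceMomentsAbstract

open ValuativeRel IsLocalRing Field
open Literature.NumberTheory.GaloisRepresentations Literature.NumberTheory.GaloisRepresentations.IsNonarchimedeanLocalField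
  Literature.NumberTheory.GaloisRepresentations.LubinTate Literature.NumberTheory.PAdicHodge

variable {F : Type} [Field F] [ValuativeRel F] [TopologicalSpace F] [IsNonarchimedeanLocalField F]

attribute [local instance] ltNormUniformSpace ltNormIsUniformAddGroup rk1 nF nE fintypeResidueField

variable (hq : residueFieldCard F = 2) (h2 : (valuation F).IsUniformizer (((2 : ℕ) : 𝒪[F]) : F))
  {σ₀ : absoluteGaloisGroup F} (hσ₀ : IsAbsArithFrob σ₀) (u : 𝒪[F]ˣ)
  {ε : (maxUnramifiedCompletion F)ˣ}
  (hε : maxUnramifiedCompletion.galAut F σ₀ (ε : maxUnramifiedCompletion F) =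
    algebraMap 𝒪[F] (maxUnramifiedCompletion F) (u : 𝒪[F]) * (ε : maxUnramifiedCompletion F))
variable (θ : CompletedAlgClosure F →+* ℂ_[2]) (hθc : Continuous θ)
  (hθ1 : ∀ z : CBall F, ‖θ (z : CompletedAlgClosure F)‖ ≤ 1)
  (hθζ : ∀ ζ' : ℂ_[2], (∃ n : ℕ, ζ' ^ 2 ^ n = 1) →
    ∃ ζ : CompletedAlgClosure F, (∃ n : ℕ, ζ ^ 2 ^ n = 1) ∧ θ ζ = ζ')
variable {G : Type*} [Group G] {𝒰 : SubgroupTower G} [∀ n, (𝒰.U n).Normal] (κ : G →* ℤ_[2]ˣ)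
  (hU : ∀ (n : ℕ) (g : G), g ∈ 𝒰.U n ↔ g ∈ 𝒰.U 0 ∧ PadicInt.toZModPow (n + 1) (κ g : ℤ_[2]) = 1)
  (hκ : ∀ (n : ℕ) (w : ℤ_[2]ˣ), PadicInt.toZModPow 1 (w : ℤ_[2]) = 1 →
    ∃ g ∈ 𝒰.U 0, PadicInt.toZModPow (n + 1) (κ g : ℤ_[2]) = PadicInt.toZModPow (n + 1) (w : ℤ_[2]))
  (ψ : (n : ℕ) → G ⧸ 𝒰.U n → ZMod (2 ^ (n + 1)))
  (hψ : ∀ (n : ℕ) (g : G), g ∈ 𝒰.U 0 → ψ n (𝒰.proj n g) = PadicInt.toZModPow (n + 1) (κ g : ℤ_[2]))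

/-- The `Θ`- and `θ`-currency pulled-back measures agree levelwise along the abstract tower (any bound proof in
the `Θ`-currency). [cite: deShalit1987, I.3.3 (8)–(9) (p. 17–18)] -/
theorem comap_μ_normCoherentUnits_comp_eq_of_character (β : NormCoherentUnits (isUniformizer_unit_mul h2 u)) {C : ℝ}
    (hC : ∀ k : ℕ, ‖PowerSeries.coeff k ((PowerSeries.subst (compSeriesC h2 hσ₀ u hε)
          ((tildeSer ((u : 𝒪[F]) * ((2 : ℕ) : 𝒪[F])) (LTCoeff.of F (u : 𝒪[F])) β.logDeriv).map
            ((intToUnrCoeff F).comp (LTCoeff.of F).symm.toRingHom))).map (θ.comp ((CBall F).subtype.comp (algebraMap (UnrCoeff F) (CBall F)))))‖ ≤ C) (n : ℕ) (a : G ⧸ 𝒰.U n) :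
    (GroupDistribution.comap (restrictUnits ((invAmice₁ 2 ((PowerSeries.subst (compSeriesC h2 hσ₀ u hε)
          ((tildeSer ((u : 𝒪[F]) * ((2 : ℕ) : 𝒪[F])) (LTCoeff.of F (u : 𝒪[F])) β.logDeriv).map
            ((intToUnrCoeff F).comp (LTCoeff.of F).symm.toRingHom))).map (θ.comp ((CBall F).subtype.comp (algebraMap (UnrCoeff F) (CBall F))))) hC).density
          (ProfiniteTower.padicInt_isUniform 2) (unitInv ℂ_[2]) uniformContinuous_unitInv norm_unitInv_le))
          ψ (𝒰.cellMap_trans κ ψ hψ) (𝒰.cellMap_injective κ hU ψ hψ) (𝒰.cellMap_fiberSurj κ hU hκ ψ hψ)).μ n a =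
      (GroupDistribution.comap (restrictUnits ((invAmice₁ 2 ((PowerSeries.subst ((compSeriesC h2 hσ₀ u hε).map (algebraMap (UnrCoeff F) (CBall F)))
          ((tildeSer ((u : 𝒪[F]) * ((2 : ℕ) : 𝒪[F])) (LTCoeff.of F (u : 𝒪[F])) β.logDeriv).map
            ((algebraMap (UnrCoeff F) (CBall F)).comp
              ((intToUnrCoeff F).comp (LTCoeff.of F).symm.toRingHom)))).map (θ.comp (CBall F).subtype)) (norm_coeff_map_le_one θ hθ1
          (PowerSeries.subst ((compSeriesC h2 hσ₀ u hε).map (algebraMap (UnrCoeff F) (CBall F)))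
            ((tildeSer ((u : 𝒪[F]) * ((2 : ℕ) : 𝒪[F])) (LTCoeff.of F (u : 𝒪[F])) β.logDeriv).map
              ((algebraMap (UnrCoeff F) (CBall F)).comp
                ((intToUnrCoeff F).comp (LTCoeff.of F).symm.toRingHom)))))).density
          (ProfiniteTower.padicInt_isUniform 2) (unitInv ℂ_[2]) uniformContinuous_unitInv norm_unitInv_le))
          ψ (𝒰.cellMap_trans κ ψ hψ) (𝒰.cellMap_injective κ hU ψ hψ) (𝒰.cellMap_fiberSurj κ hU hκ ψ hψ)).μ n a := by
  have h₁ := invAmice₁_μ_congr (p := 2) (map_subst_compSeriesC_comp_eq h2 hσ₀ u hε θ _) hC (norm_coeff_map_le_one θ hθ1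
          (PowerSeries.subst ((compSeriesC h2 hσ₀ u hε).map (algebraMap (UnrCoeff F) (CBall F)))
            ((tildeSer ((u : 𝒪[F]) * ((2 : ℕ) : 𝒪[F])) (LTCoeff.of F (u : 𝒪[F])) β.logDeriv).map
              ((algebraMap (UnrCoeff F) (CBall F)).comp
                ((intToUnrCoeff F).comp (LTCoeff.of F).symm.toRingHom)))))
  have h₂ := BoundedDistribution.density_μ_congr_of_μ_eq _ _ h₁ (ProfiniteTower.padicInt_isUniform 2)
    (unitInv ℂ_[2]) uniformContinuous_unitInv norm_unitInv_le
  have h₃ := restrictUnits_μ_congr_of_μ_eq _ _ h₂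
  exact GroupDistribution.comap_μ_congr_of_μ_eq (T := (ProfiniteTower.padicInt 2).succ) _ _ ψ _ _ _ h₃ n a

include hq hθc hθ1 hθζ in
/-- **De Shalit's (10)+(11) along the abstract tower, `Θ`-currency**: for a norm-coherent unit `β`,
`∫_G 𝟙_{U_0}(g) κ(g)^{k+1} dD_β(g) = [S^0] D^k H_β`. [cite: deShalit1987, I.3.4 (10), I.3.5 (11) (p. 18)] -/
theorem integral_comap_indicator_character_pow_succ_normCoherentUnits_of_character (n₀ : ℕ)
    (β : NormCoherentUnits (isUniformizer_unit_mul h2 u)) {C : ℝ}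
    (hC : ∀ k : ℕ, ‖PowerSeries.coeff k ((PowerSeries.subst (compSeriesC h2 hσ₀ u hε)
          ((tildeSer ((u : 𝒪[F]) * ((2 : ℕ) : 𝒪[F])) (LTCoeff.of F (u : 𝒪[F])) β.logDeriv).map
            ((intToUnrCoeff F).comp (LTCoeff.of F).symm.toRingHom))).map (θ.comp ((CBall F).subtype.comp (algebraMap (UnrCoeff F) (CBall F)))))‖ ≤ C) (k : ℕ) :
    (GroupDistribution.comap (restrictUnits ((invAmice₁ 2 ((PowerSeries.subst (compSeriesC h2 hσ₀ u hε)
          ((tildeSer ((u : 𝒪[F]) * ((2 : ℕ) : 𝒪[F])) (LTCoeff.of F (u : 𝒪[F])) β.logDeriv).map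
            ((intToUnrCoeff F).comp (LTCoeff.of F).symm.toRingHom))).map (θ.comp ((CBall F).subtype.comp (algebraMap (UnrCoeff F) (CBall F))))) hC).density
          (ProfiniteTower.padicInt_isUniform 2) (unitInv ℂ_[2]) uniformContinuous_unitInv norm_unitInv_le))
          ψ (𝒰.cellMap_trans κ ψ hψ) (𝒰.cellMap_injective κ hU ψ hψ) (𝒰.cellMap_fiberSurj κ hU hκ ψ hψ)).integral
        (fun g ↦ (if 𝒰.proj 0 g = 1 then (1 : ℂ_[2]) else 0) * padicIntCast ℂ_[2] ((κ g : ℤ_[2]) ^ (k + 1))) =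
      PowerSeries.constantCoeff (mahlerD^[k] ((PowerSeries.subst ((compSeriesC h2 hσ₀ u hε).map (algebraMap (UnrCoeff F) (CBall F)))
          ((tildeSer ((u : 𝒪[F]) * ((2 : ℕ) : 𝒪[F])) (LTCoeff.of F (u : 𝒪[F])) β.logDeriv).map
            ((algebraMap (UnrCoeff F) (CBall F)).comp
              ((intToUnrCoeff F).comp (LTCoeff.of F).symm.toRingHom)))).map (θ.comp (CBall F).subtype))) := by
  rw [GroupDistribution.integral_congr_of_μ_eq _ _
    (comap_μ_normCoherentUnits_comp_eq_of_character h2 hσ₀ u hε θ hθ1 κ hU hκ ψ hψ β hC) _]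
  exact integral_comap_character_pow_succ_of_colemanTrace_eq_zero hq h2 hσ₀ u hε θ hθc hθ1 hθζ κ hU hκ ψ hψ n₀ _
    (colemanTrace_tildeSer_logDeriv (isUniformizer_unit_mul h2 u) n₀ (of_unit_mul_two_eq hq u) β) k

/-! ### §3. The coset formula for the moments of `i(b)` (II.4.7 (16)–(17)) -/

variable (e : 𝒪[F] →+* ℤ_[2])
  (hΘe : ∀ a : 𝒪[F], (θ.comp ((CBall F).subtype.comp (algebraMap (UnrCoeff F) (CBall F)))) (intToUnrCoeff F a) =
    padicIntCast ℂ_[2] (e a))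
variable {B : Type*} [Monoid B] [MulDistribMulAction G B]
  (η : B → NormCoherentUnits (isUniformizer_unit_mul h2 u))
  (hη : ∀ g ∈ 𝒰.U 0, ∀ b : B, ∃ σ : absoluteGaloisGroup F, η (g • b) = (η b).galAct σ ∧
    Units.map (e : 𝒪[F] →* ℤ_[2]) (lubinTateChar (isUniformizer_unit_mul h2 u) σ) = κ g)
  {C : ℝ}
  (hC : ∀ (b : B) (k : ℕ), ‖PowerSeries.coeff k ((PowerSeries.subst (compSeriesC h2 hσ₀ u hε)
          ((tildeSer ((u : 𝒪[F]) * ((2 : ℕ) : 𝒪[F])) (LTCoeff.of F (u : 𝒪[F])) (η b).logDeriv).map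
            ((intToUnrCoeff F).comp (LTCoeff.of F).symm.toRingHom))).map (θ.comp ((CBall F).subtype.comp (algebraMap (UnrCoeff F) (CBall F)))))‖ ≤ C)
  (hC0 : 0 ≤ C)
  (hCb : ∀ b : B, (GroupDistribution.comap (restrictUnits ((invAmice₁ 2 ((PowerSeries.subst (compSeriesC h2 hσ₀ u hε)
          ((tildeSer ((u : 𝒪[F]) * ((2 : ℕ) : 𝒪[F])) (LTCoeff.of F (u : 𝒪[F])) (η b).logDeriv).map
            ((intToUnrCoeff F).comp (LTCoeff.of F).symm.toRingHom))).map (θ.comp ((CBall F).subtype.comp (algebraMap (UnrCoeff F) (CBall F))))) (hC b)).density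
          (ProfiniteTower.padicInt_isUniform 2) (unitInv ℂ_[2]) uniformContinuous_unitInv norm_unitInv_le))
          ψ (𝒰.cellMap_trans κ ψ hψ) (𝒰.cellMap_injective κ hU ψ hψ) (𝒰.cellMap_fiberSurj κ hU hκ ψ hψ)).bound ≤ C)

include hq hθc hθ1 hθζ in
/-- ★★★ **The coset formula for the moments of `i(b)`** (de Shalit II.4.7 (16)–(17) along an abstract tower):
`∫_G κ(g)^{k+1} d i(b)(g) = Σ_{c ∈ G/U_0} κ(r_c)^{k+1} · [S^0] D^k H_{η(r_c⁻¹ • b)}` with `r_c = 𝒰.repr 0 c` the chosen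
coset representatives and `H_{β} = θ((δβ)~ ∘ ϑ)` — on each coset `r_c U_0` the measure `i(b)` is the translate of
`D_{η(r_c⁻¹ • b)}`, whose `(k+1)`-st moment is `δ̃_{k+1}(η(r_c⁻¹ • b))`.
[cite: deShalit1987, II.4.7 (16)–(17) (p. 60), I.3.5 (11) (p. 18)] -/
theorem integral_induce_character_pow_succ_of_character (n₀ : ℕ) (b : B) (k : ℕ) :
    (GroupDistribution.induce (fun b ↦ (GroupDistribution.comap (restrictUnits ((invAmice₁ 2 ((PowerSeries.subst (compSeriesC h2 hσ₀ u hε)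
          ((tildeSer ((u : 𝒪[F]) * ((2 : ℕ) : 𝒪[F])) (LTCoeff.of F (u : 𝒪[F])) (η b).logDeriv).map
            ((intToUnrCoeff F).comp (LTCoeff.of F).symm.toRingHom))).map (θ.comp ((CBall F).subtype.comp (algebraMap (UnrCoeff F) (CBall F))))) (hC b)).density
          (ProfiniteTower.padicInt_isUniform 2) (unitInv ℂ_[2]) uniformContinuous_unitInv norm_unitInv_le))
          ψ (𝒰.cellMap_trans κ ψ hψ) (𝒰.cellMap_injective κ hU ψ hψ) (𝒰.cellMap_fiberSurj κ hU hκ ψ hψ))) hC0 hCb b).integral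
        (fun g ↦ padicIntCast ℂ_[2] ((κ g : ℤ_[2]) ^ (k + 1))) =
      ∑ c ∈ 𝒰.cells 0, padicIntCast ℂ_[2] ((κ (𝒰.repr 0 c) : ℤ_[2]) ^ (k + 1)) *
        PowerSeries.constantCoeff (mahlerD^[k] ((PowerSeries.subst ((compSeriesC h2 hσ₀ u hε).map (algebraMap (UnrCoeff F) (CBall F)))
          ((tildeSer ((u : 𝒪[F]) * ((2 : ℕ) : 𝒪[F])) (LTCoeff.of F (u : 𝒪[F])) (η ((𝒰.repr 0 c)⁻¹ • b)).logDeriv).map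
            ((algebraMap (UnrCoeff F) (CBall F)).comp
              ((intToUnrCoeff F).comp (LTCoeff.of F).symm.toRingHom)))).map (θ.comp (CBall F).subtype))) := by
  rw [GroupDistribution.integral_induce _ hC0 hCb b
    (SubgroupTower.isTowerContinuous_padicIntCast_character_pow κ hU (k + 1))]
  refine Finset.sum_congr rfl (fun c _ ↦ ?_)
  have hfun : ∀ y : G, (if 𝒰.proj 0 y = 1 then (1 : ℂ_[2]) else 0) *
      padicIntCast ℂ_[2] ((κ (𝒰.repr 0 c * y) : ℤ_[2]) ^ (k + 1)) =
      padicIntCast ℂ_[2] ((κ (𝒰.repr 0 c) : ℤ_[2]) ^ (k + 1)) *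
        ((if 𝒰.proj 0 y = 1 then (1 : ℂ_[2]) else 0) * padicIntCast ℂ_[2] ((κ y : ℤ_[2]) ^ (k + 1))) := by
    intro y
    rw [map_mul, Units.val_mul, mul_pow, map_mul]
    ring
  rw [GroupDistribution.integral_congr _ hfun, GroupDistribution.integral_const_mul _ _
    (SubgroupTower.isTowerContinuous_indicator_mul_comp (T := (ProfiniteTower.padicInt 2).succ) ψ
      (Ψ := fun g ↦ (κ g : ℤ_[2])) (𝒰.proj_coe_character_eq_cellMap κ ψ hψ)
      (uniformContinuous_padicIntCast_pow (𝕜 := ℂ_[2]) (k + 1))),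
    integral_comap_indicator_character_pow_succ_normCoherentUnits_of_character hq h2 hσ₀ u hε θ hθc hθ1 hθζ κ hU hκ ψ
      hψ n₀ _ (hC _) k]

end InduceMomentsAbstract

end Literature.NumberTheory.EllipticCurves

end
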